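import Literature.NumberTheory.Sieve.LiouvillePolynomialValuesWeylTopCoeff
import HarnessLib

/-!
# Quadratic Weyl sums (inverse form) and recurrent square phases `κd²` (Green–Tao AIF §7 tools)

Topic `Literature/NumberTheory/Sieve`. Everything in this file is PROVED (theorems only; no
definitions, no named facts).

Two tools for the minor-arc analysis of `∑_{n ≤ N} μ(n) e(αn² + βn)` (Hua's estimate; B. Green,
T. Tao, *Quadratic uniformity of the Möbius function*, Ann. Inst. Fourier 58 (2008), §7
[GreenTao2008QuadraticMobius]):

* `QuadraticMoebius.exists_distInt_mul_le_of_norm_quadratic_sum_ge` — the quadratic WEYL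
  INEQUALITY in inverse form (loc. cit. Appendix A, Lemma "Weyl's inequality"; Green–Tao 2012,
  Lemma 4.4): if `‖∑_{a<n≤a+L} e(θ₂n² + θ₁n)‖ ≥ ηL` then some `1 ≤ k ≤ C(8/η²)^A` has
  `‖kθ₂‖_{ℝ/ℤ} ≤ C(8/η²)^A/L²`. This is the degree-`2` case of the tree's
  `Literature.NumberTheory.Sieve.Teravainen2024.weyl_topCoeff`, restated for Mathlib's `𝐞`.
* `QuadraticMoebius.exists_distInt_mul_le_of_sq_recurrent` — RECURRENT SQUARE PHASES ARE MAJOR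
  ARC (the argument of loc. cit. §7, proof of Proposition 7.2 = arXiv Prop. 17, case `D` large):
  if `‖κd² − θ‖_{ℝ/ℤ} ≤ ε` for at least `cD` integers `d ∈ [1, D]`, then, provided `D ≫_c 1` and
  `ε ≪_c 1, D`, some `q ≪_c 1` has `‖qκ‖_{ℝ/ℤ} ≪_c ε/D²`. Proof as printed: many pairs give
  `‖κ(d² − d'²)‖ ≤ 2ε`; write `d² − d'² = d₁d₂`; for many `d₁` the linear phase `(κd₁)d₂` is
  recurrent in `d₂`, so (the tree's Vinogradov lemma
  `Teravainen2024.exists_denominator_of_recurrent_linear` = loc. cit. Lemma A "recurrent linear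
  functions are major arc" (ii)) `‖q_{d₁}κd₁‖ ≪ ε/D`; pigeonhole `q_{d₁} = q₀` and apply the
  Vinogradov lemma once more in `d₁`. All constants are explicit powers of `c`.

`‖x‖_{ℝ/ℤ}` is `Literature.NumberTheory.Sieve.Vinogradov.distInt x = |x − round x|`.

## References
* B. Green, T. Tao, Ann. Inst. Fourier 58 (2008) 1863–1935, §7 and Appendix A.
  [GreenTao2008QuadraticMobius]
* B. Green, T. Tao, Ann. of Math. 175 (2012) 465–540, Lemmas 3.2 and 4.4. [GreenTao2012Nilmanifolds]
-/

noncomputable section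

open Finset Real
open scoped FourierTransform

namespace Literature.NumberTheory.Sieve.QuadraticMoebius

open Literature.NumberTheory.Sieve.Vinogradov (distInt distInt_nonneg distInt_add_le distInt_neg)
open Literature.NumberTheory.Sieve.Teravainen2024
open Literature.NumberTheory.LFunctions
open Polynomial

/-! ### The quadratic Weyl inequality, inverse form -/

/-- Mathlib's `𝐞` and the tree's `VdC.e` agree. [folklore] -/
private theorem fourierChar_coe_eq_e (x : ℝ) : (𝐞 x : ℂ) = VdC.e x := by
  rw [Real.fourierChar_apply, VdC.e]

/-- Sums over `a < n ≤ a + L` in `ℤ` are sums over `Ioc a (a + L)` in `ℕ`. [folklore] -/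
private theorem sum_Ioc_natCast_eq {M : Type*} [AddCommMonoid M] (a L : ℕ) (F : ℤ → M) :
    ∑ n ∈ Finset.Ioc (a : ℤ) ((a : ℤ) + L), F n = ∑ m ∈ Ioc a (a + L), F m := by
  refine (sum_nbij' (fun m : ℕ => (m : ℤ)) (fun n : ℤ => n.toNat) ?_ ?_ ?_ ?_ ?_).symm
  · intro m hm
    rw [mem_Ioc] at hm
    rw [mem_Ioc]
    omega
  · intro n hn
    rw [mem_Ioc] at hn
    rw [mem_Ioc]
    omega
  · intro m _
    simp
  · intro n hn
    rw [mem_Ioc] at hn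
    exact Int.toNat_of_nonneg (by omega)
  · intro m _
    rfl

/-- **Weyl's inequality for quadratic phases, inverse form.** There are `A ∈ ℕ` and `C ≥ 1` such
that: if `0 < η ≤ 1`, `L ≥ 1` and `‖∑_{a<n≤a+L} e(θ₂n² + θ₁n)‖ ≥ ηL`, then some `1 ≤ k ≤ C(8/η²)^A`
has `‖kθ₂‖_{ℝ/ℤ} ≤ C(8/η²)^A/L²`. (Degree `2` of the tree's `Teravainen2024.weyl_topCoeff`.)
[cite: GreenTao2008QuadraticMobius, Appendix A, Lemma (Weyl's inequality)]
[cite: GreenTao2012Nilmanifolds, Lemma 4.4] -/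
theorem exists_distInt_mul_le_of_norm_quadratic_sum_ge :
    ∃ (A : ℕ) (C : ℝ), 1 ≤ C ∧
      ∀ (η : ℝ) (a L : ℕ) (θ₂ θ₁ : ℝ), 0 < η → η ≤ 1 → 1 ≤ L →
        η * L ≤ ‖∑ n ∈ Ioc a (a + L), (𝐞 (θ₂ * (n : ℝ) ^ 2 + θ₁ * n) : ℂ)‖ →
        ∃ k : ℕ, 1 ≤ k ∧ (k : ℝ) ≤ C * (8 / η ^ 2) ^ A ∧
          distInt (k * θ₂) ≤ C * (8 / η ^ 2) ^ A / (L : ℝ) ^ 2 := by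
  obtain ⟨A, C, hC1, hW⟩ := weyl_topCoeff 2 (by norm_num)
  refine ⟨A, C, hC1, fun η a L θ₂ θ₁ hη hη1 hL hS => ?_⟩
  set p : ℝ[X] := Polynomial.C θ₂ * X ^ 2 + Polynomial.C θ₁ * X with hp
  have hdeg : p.natDegree ≤ 2 := by
    rw [hp]
    refine (Polynomial.natDegree_add_le _ _).trans (max_le ?_ ?_)
    · exact Polynomial.natDegree_C_mul_X_pow_le θ₂ 2
    · calc (Polynomial.C θ₁ * X).natDegree = (Polynomial.C θ₁ * X ^ 1).natDegree := by
              rw [pow_one]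
          _ ≤ 1 := Polynomial.natDegree_C_mul_X_pow_le θ₁ 1
          _ ≤ 2 := by norm_num
  have hcoeff : p.coeff 2 = θ₂ := by
    rw [hp]; simp
  have hev : ∀ x : ℝ, p.eval x = θ₂ * x ^ 2 + θ₁ * x := by
    intro x; rw [hp]; simp
  have hsum : ∑ n ∈ Ioc a (a + L), (𝐞 (θ₂ * (n : ℝ) ^ 2 + θ₁ * n) : ℂ) =
      ∑ n ∈ Finset.Ioc (a : ℤ) ((a : ℤ) + L), VdC.e (p.eval (n : ℝ)) := by
    rw [sum_Ioc_natCast_eq a L (fun n : ℤ => VdC.e (p.eval (n : ℝ)))]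
    refine Finset.sum_congr rfl fun m _ => ?_
    rw [fourierChar_coe_eq_e, hev]
    push_cast
    ring_nf
  rw [hsum] at hS
  obtain ⟨k, hk1, hkC, hdist⟩ := hW η (a : ℤ) L p hη hη1 hdeg hL hS
  rw [hcoeff] at hdist
  exact ⟨k, hk1, hkC, hdist⟩

/-! ### Recurrent square phases are major arc -/

/-- The tree's Vinogradov lemma (`Teravainen2024.exists_denominator_of_recurrent_linear`), with
the distance to `ℤ` written `distInt`. [folklore] -/
private theorem vinogradov_distInt {α δ ε : ℝ} {N : ℕ} (hδ0 : 0 < δ) (hδ1 : δ ≤ 1) (hε0 : 0 < ε)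
    (hεδ : ε ≤ δ / 32) (hN : 24 / δ ^ 2 ≤ N)
    (hS : δ * N ≤ #((Icc 1 N).filter fun n : ℕ => distInt ((n : ℝ) * α) ≤ ε)) :
    ∃ q : ℕ, 1 ≤ q ∧ (q : ℝ) ≤ 2 / δ ∧ distInt ((q : ℝ) * α) ≤ 48 * ε / (δ ^ 2 * N) :=
  exists_denominator_of_recurrent_linear hδ0 hδ1 hε0 hεδ hN hS

/-- `‖x − y‖ ≤ ‖x‖ + ‖y‖` for the distance to `ℤ`. [folklore] -/
private theorem distInt_sub_le' (x y : ℝ) : distInt (x - y) ≤ distInt x + distInt y := by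
  have h := distInt_add_le x (-y)
  rwa [distInt_neg, ← sub_eq_add_neg] at h

/-- Counting ordered pairs: `#G² ≤ 2 #{(d, d') ∈ G² : d' < d} + #G`. [folklore] -/
private theorem card_product_le_two_mul_card_lt_add (G : Finset ℕ) :
    #(G ×ˢ G) ≤ 2 * #((G ×ˢ G).filter fun p : ℕ × ℕ => p.2 < p.1) + #G := by
  classical
  have hQP : #((G ×ˢ G).filter fun p : ℕ × ℕ => p.1 < p.2) =
      #((G ×ˢ G).filter fun p : ℕ × ℕ => p.2 < p.1) := by
    refine Finset.card_nbij' (fun p => p.swap) (fun p => p.swap) ?_ ?_ ?_ ?_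
    · intro p hp
      have hp' := Finset.mem_filter.mp hp
      have hpp := Finset.mem_product.mp hp'.1
      exact Finset.mem_filter.mpr ⟨Finset.mem_product.mpr ⟨hpp.2, hpp.1⟩, hp'.2⟩
    · intro p hp
      have hp' := Finset.mem_filter.mp hp
      have hpp := Finset.mem_product.mp hp'.1
      exact Finset.mem_filter.mpr ⟨Finset.mem_product.mpr ⟨hpp.2, hpp.1⟩, hp'.2⟩
    · intro p _; simp
    · intro p _; simp
  have hΔG : #(G.image fun d : ℕ => (d, d)) ≤ #G := Finset.card_image_le
  have hcover : G ×ˢ G ⊆ ((G ×ˢ G).filter fun p : ℕ × ℕ => p.2 < p.1) ∪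
      ((G ×ˢ G).filter fun p : ℕ × ℕ => p.1 < p.2) ∪ (G.image fun d : ℕ => (d, d)) := by
    intro p hp
    rw [Finset.mem_product] at hp
    rcases lt_trichotomy p.2 p.1 with h | h | h
    · exact Finset.mem_union_left _ (Finset.mem_union_left _
        (Finset.mem_filter.mpr ⟨Finset.mem_product.mpr hp, h⟩))
    · refine Finset.mem_union_right _ (Finset.mem_image.mpr ⟨p.1, hp.1, ?_⟩)
      exact Prod.ext rfl h.symm
    · exact Finset.mem_union_left _ (Finset.mem_union_right _
        (Finset.mem_filter.mpr ⟨Finset.mem_product.mpr hp, h⟩))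
  calc #(G ×ˢ G) ≤ #(((G ×ˢ G).filter fun p : ℕ × ℕ => p.2 < p.1) ∪
        ((G ×ˢ G).filter fun p : ℕ × ℕ => p.1 < p.2) ∪ (G.image fun d : ℕ => (d, d))) :=
        Finset.card_le_card hcover
    _ ≤ #(((G ×ˢ G).filter fun p : ℕ × ℕ => p.2 < p.1) ∪
        ((G ×ˢ G).filter fun p : ℕ × ℕ => p.1 < p.2)) + #(G.image fun d : ℕ => (d, d)) :=
        Finset.card_union_le _ _
    _ ≤ #((G ×ˢ G).filter fun p : ℕ × ℕ => p.2 < p.1) +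
        #((G ×ˢ G).filter fun p : ℕ × ℕ => p.1 < p.2) + #(G.image fun d : ℕ => (d, d)) := by
        gcongr; exact Finset.card_union_le _ _
    _ ≤ 2 * #((G ×ˢ G).filter fun p : ℕ × ℕ => p.2 < p.1) + #G := by rw [hQP]; omega

/-- Bookkeeping identity for the constants of `exists_distInt_mul_le_of_sq_recurrent`.
[folklore] -/
private theorem final_identity (c ε D : ℝ) (hc : c ≠ 0) (hD : D ≠ 0) :
    48 * (48 * 1024 * ε / (c ^ 4 * D)) / ((c ^ 4 / 1024) ^ 2 * D) =
      (2304 * 2 ^ 30 / c ^ 12) * ε / D ^ 2 := by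
  field_simp
  ring

/-- Bookkeeping bound for the constants of `exists_distInt_mul_le_of_sq_recurrent`
(`2304 · 2³⁰ ≤ 2⁴²`). [folklore] -/
private theorem final_bound (c ε D : ℝ) (hc : 0 < c) (hD : 0 < D) (hε : 0 ≤ ε) :
    48 * (48 * 1024 * ε / (c ^ 4 * D)) / ((c ^ 4 / 1024) ^ 2 * D) ≤
      2 ^ 42 / c ^ 12 * ε / D ^ 2 := by
  rw [final_identity c ε D hc.ne' hD.ne']
  have h : (2304 * 2 ^ 30 / c ^ 12 : ℝ) ≤ 2 ^ 42 / c ^ 12 :=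
    div_le_div_of_nonneg_right (by norm_num) (by positivity)
  exact div_le_div_of_nonneg_right (mul_le_mul_of_nonneg_right h hε) (by positivity)

/-- **Recurrent square phases are major arc** (Green–Tao, AIF 2008, §7, the argument proving
Proposition 7.2 = arXiv Prop. 17 in the case `D` large): let `0 < c ≤ 1`, `ε > 0`, and let
`G ⊆ [1, D]` have at least `cD` elements, each with `‖κd² − θ‖_{ℝ/ℤ} ≤ ε`. If `c⁸D ≥ 2²⁵` and
`2¹¹ε ≤ c²`, then some `1 ≤ q ≤ 2¹⁷/c⁶` has `‖qκ‖_{ℝ/ℤ} ≤ 2⁴² c⁻¹² ε/D²`.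
("Many pairs give `‖κ(d² − d'²)‖ ≤ 2ε`; writing `d² − d'² = d₁d₂`, for `≳ D` values of `d₁` the
phase `κd₁d₂` is recurrent in `d₂ ≤ 2D`, so Lemma A (ii) gives `‖q_{d₁}κd₁‖ ≲ ε/D`; pigeonhole in
`q_{d₁}` and apply Lemma A (ii) again.")
[cite: GreenTao2008QuadraticMobius, §7, proof of Proposition 7.2 (correlation with quadratic
phase implies major arc, II)] -/
theorem exists_distInt_mul_le_of_sq_recurrent {κ θ ε c : ℝ} {D : ℕ} (hc0 : 0 < c) (hc1 : c ≤ 1)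
    (hε0 : 0 < ε) (G : Finset ℕ) (hG : G ⊆ Icc 1 D) (hcard : c * D ≤ #G)
    (hgood : ∀ d ∈ G, distInt (κ * (d : ℝ) ^ 2 - θ) ≤ ε)
    (hD : (2 : ℝ) ^ 25 ≤ c ^ 8 * D) (hε₁ : 2 ^ 11 * ε ≤ c ^ 2) :
    ∃ q : ℕ, 1 ≤ q ∧ (q : ℝ) ≤ 2 ^ 17 / c ^ 6 ∧
      distInt (q * κ) ≤ 2 ^ 42 / c ^ 12 * ε / (D : ℝ) ^ 2 := by
  classical
  -- sizes
  have hc8 : c ^ 8 ≤ 1 := pow_le_one₀ hc0.le hc1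
  have hc4 : c ^ 4 ≤ 1 := pow_le_one₀ hc0.le hc1
  have hc2 : c ^ 2 ≤ 1 := pow_le_one₀ hc0.le hc1
  have hc48 : c ^ 8 ≤ c ^ 4 := pow_le_pow_of_le_one hc0.le hc1 (by norm_num)
  have hD0 : (0 : ℝ) < D := by
    by_contra h
    linarith only [mul_nonpos_of_nonneg_of_nonpos (pow_pos hc0 8).le (not_lt.mp h), hD]
  have hDr : (2 : ℝ) ^ 25 ≤ D := by
    linarith only [mul_le_mul_of_nonneg_right hc8 hD0.le, hD]
  have hGD : #G ≤ D := by simpa using Finset.card_le_card hG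
  have hGDr : (#G : ℝ) ≤ D := by exact_mod_cast hGD
  -- Step 1: many pairs `d' < d` in `G`
  set P := (G ×ˢ G).filter fun p : ℕ × ℕ => p.2 < p.1 with hPdef
  have hPcard : c ^ 2 * (D : ℝ) ^ 2 / 4 ≤ #P := by
    have h1 := card_product_le_two_mul_card_lt_add G
    rw [Finset.card_product] at h1
    have h2 : ((#G : ℕ) : ℝ) * #G ≤ 2 * #P + #G := by exact_mod_cast h1
    have h3 : c ^ 2 * (D : ℝ) ^ 2 ≤ (#G : ℝ) * #G := by
      have := mul_le_mul hcard hcard (by positivity) (Nat.cast_nonneg _)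
      linarith only [this]
    -- `D ≤ c² D²/2` as `c⁸ D ≥ 2^25`
    have h4 : (D : ℝ) ≤ c ^ 2 * (D : ℝ) ^ 2 / 2 := by
      have h5 : c ^ 8 * (D : ℝ) ≤ c ^ 2 * D :=
        mul_le_mul_of_nonneg_right (pow_le_pow_of_le_one hc0.le hc1 (by norm_num)) hD0.le
      have h6 : (2 : ℝ) ≤ c ^ 2 * D := by linarith only [h5, hD]
      linarith only [mul_le_mul_of_nonneg_right h6 hD0.le]
    linarith only [h2, h3, h4, hGDr]
  -- Step 2: the pairs give products `d₁ d₂` with `‖κ d₁ d₂‖ ≤ 2ε`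
  set T' := (Icc 1 D ×ˢ Icc 1 (2 * D)).filter
    fun p : ℕ × ℕ => distInt ((p.2 : ℝ) * (κ * p.1)) ≤ 2 * ε with hT'def
  have hT'card : c ^ 2 * (D : ℝ) ^ 2 / 4 ≤ #T' := by
    set f : ℕ × ℕ → ℕ × ℕ := fun p => (p.1 - p.2, p.1 + p.2) with hf
    have hinj : Set.InjOn f P := by
      intro p hp p' hp' h
      simp only [hPdef, Finset.coe_filter, Set.mem_setOf_eq] at hp hp'
      simp only [hf, Prod.mk.injEq] at h
      have h1 : p.1 = p'.1 := by omega
      have h2 : p.2 = p'.2 := by omega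
      exact Prod.ext h1 h2
    have himg : P.image f ⊆ T' := by
      intro x hx
      rw [Finset.mem_image] at hx
      obtain ⟨p, hp, rfl⟩ := hx
      simp only [hPdef, Finset.mem_filter, Finset.mem_product] at hp
      obtain ⟨⟨hp1, hp2⟩, hlt⟩ := hp
      have hd := Finset.mem_Icc.mp (hG hp1)
      have hd' := Finset.mem_Icc.mp (hG hp2)
      simp only [hT'def, hf, Finset.mem_filter, Finset.mem_product, Finset.mem_Icc]
      refine ⟨⟨⟨by omega, by omega⟩, ⟨by omega, by omega⟩⟩, ?_⟩
      have e : (((p.1 + p.2 : ℕ) : ℝ)) * (κ * ((p.1 - p.2 : ℕ) : ℝ)) =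
          (κ * (p.1 : ℝ) ^ 2 - θ) - (κ * (p.2 : ℝ) ^ 2 - θ) := by
        rw [Nat.cast_sub hlt.le]; push_cast; ring
      rw [e]
      calc distInt ((κ * (p.1 : ℝ) ^ 2 - θ) - (κ * (p.2 : ℝ) ^ 2 - θ))
          ≤ distInt (κ * (p.1 : ℝ) ^ 2 - θ) + distInt (κ * (p.2 : ℝ) ^ 2 - θ) :=
            distInt_sub_le' _ _
        _ ≤ ε + ε := add_le_add (hgood _ hp1) (hgood _ hp2)
        _ = 2 * ε := by ring
    calc c ^ 2 * (D : ℝ) ^ 2 / 4 ≤ #P := hPcard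
      _ = #(P.image f) := by rw [Finset.card_image_of_injOn hinj]
      _ ≤ #T' := by exact_mod_cast Finset.card_le_card himg
  -- Step 3: fibres over `d₁`
  set n : ℕ → ℕ := fun d₁ => #((Icc 1 (2 * D)).filter
    fun d₂ : ℕ => distInt ((d₂ : ℝ) * (κ * d₁)) ≤ 2 * ε) with hndef
  have hT'sum : #T' = ∑ d₁ ∈ Icc 1 D, n d₁ := by
    rw [hT'def, Finset.card_filter, Finset.sum_product]
    refine Finset.sum_congr rfl fun d₁ _ => ?_
    simp only [hndef, Finset.card_filter]
  have hnle : ∀ d₁, n d₁ ≤ 2 * D := by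
    intro d₁
    calc n d₁ ≤ #(Icc 1 (2 * D)) := Finset.card_filter_le _ _
      _ = 2 * D := by simp
  -- Step 4: many good `d₁`
  set Gd := (Icc 1 D).filter fun d₁ : ℕ => c ^ 2 * D / 16 ≤ (n d₁ : ℝ) with hGddef
  have hGdcard : 3 * c ^ 2 * D / 32 ≤ (#Gd : ℝ) := by
    have hsplit : ∑ d₁ ∈ Icc 1 D, (n d₁ : ℝ) =
        ∑ d₁ ∈ Gd, (n d₁ : ℝ) +
          ∑ d₁ ∈ (Icc 1 D).filter (fun d₁ : ℕ => ¬ c ^ 2 * D / 16 ≤ (n d₁ : ℝ)), (n d₁ : ℝ) := by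
      rw [hGddef, Finset.sum_filter_add_sum_filter_not]
    have h1 : ∑ d₁ ∈ Gd, (n d₁ : ℝ) ≤ #Gd * (2 * D) := by
      calc ∑ d₁ ∈ Gd, (n d₁ : ℝ) ≤ ∑ _d₁ ∈ Gd, (2 * D : ℝ) :=
            Finset.sum_le_sum fun d₁ _ => by exact_mod_cast hnle d₁
        _ = #Gd * (2 * D) := by rw [Finset.sum_const, nsmul_eq_mul]
    have h2 : ∑ d₁ ∈ (Icc 1 D).filter (fun d₁ : ℕ => ¬ c ^ 2 * D / 16 ≤ (n d₁ : ℝ)), (n d₁ : ℝ)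
        ≤ D * (c ^ 2 * D / 16) := by
      calc ∑ d₁ ∈ (Icc 1 D).filter (fun d₁ : ℕ => ¬ c ^ 2 * D / 16 ≤ (n d₁ : ℝ)), (n d₁ : ℝ)
          ≤ ∑ _d₁ ∈ (Icc 1 D).filter (fun d₁ : ℕ => ¬ c ^ 2 * D / 16 ≤ (n d₁ : ℝ)),
              c ^ 2 * D / 16 :=
            Finset.sum_le_sum fun d₁ hd₁ => (not_le.mp (Finset.mem_filter.mp hd₁).2).le
        _ = #((Icc 1 D).filter (fun d₁ : ℕ => ¬ c ^ 2 * D / 16 ≤ (n d₁ : ℝ))) *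
              (c ^ 2 * D / 16) := by rw [Finset.sum_const, nsmul_eq_mul]
        _ ≤ D * (c ^ 2 * D / 16) := by
            refine mul_le_mul_of_nonneg_right ?_ (by positivity)
            have : #((Icc 1 D).filter (fun d₁ : ℕ => ¬ c ^ 2 * D / 16 ≤ (n d₁ : ℝ))) ≤ D := by
              calc _ ≤ #(Icc 1 D) := Finset.card_filter_le _ _
                _ = D := by simp
            exact_mod_cast this
    have h3 : c ^ 2 * (D : ℝ) ^ 2 / 4 ≤ ∑ d₁ ∈ Icc 1 D, (n d₁ : ℝ) := by
      have : ((#T' : ℕ) : ℝ) = ∑ d₁ ∈ Icc 1 D, (n d₁ : ℝ) := by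
        rw [hT'sum]; push_cast; rfl
      rw [← this]; exact hT'card
    rw [hsplit] at h3
    have h4 : c ^ 2 * (D : ℝ) ^ 2 / 4 - D * (c ^ 2 * D / 16) ≤ #Gd * (2 * D) := by
      linarith only [h1, h2, h3]
    have h5 : c ^ 2 * (D : ℝ) ^ 2 / 4 - D * (c ^ 2 * D / 16) = (3 * c ^ 2 * D / 32) * (2 * D) := by
      ring
    rw [h5] at h4
    exact le_of_mul_le_mul_right h4 (by positivity)
  -- Step 5: the Vinogradov lemma in `d₂` for each good `d₁`
  set δ₁ : ℝ := c ^ 2 / 32 with hδ₁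
  have hδ₁0 : 0 < δ₁ := by positivity
  have hδ₁1 : δ₁ ≤ 1 := by rw [hδ₁]; linarith
  have hvin₁ : ∀ d₁ ∈ Gd, ∃ q : ℕ, 1 ≤ q ∧ (q : ℝ) ≤ 2 / δ₁ ∧
      distInt ((q : ℝ) * (κ * d₁)) ≤ 48 * (2 * ε) / (δ₁ ^ 2 * (2 * D : ℕ)) := by
    intro d₁ hd₁
    have hn : c ^ 2 * D / 16 ≤ (n d₁ : ℝ) := (Finset.mem_filter.mp hd₁).2
    refine vinogradov_distInt hδ₁0 hδ₁1 (by positivity) ?_ ?_ ?_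
    · rw [hδ₁]; linarith only [hε₁]
    · rw [div_le_iff₀ (pow_pos hδ₁0 2)]
      calc (24 : ℝ) ≤ c ^ 4 * D / 512 := by
            linarith only [mul_le_mul_of_nonneg_right hc48 hD0.le, hD]
        _ = ((2 * D : ℕ) : ℝ) * δ₁ ^ 2 := by rw [hδ₁]; push_cast; ring
    · push_cast
      calc δ₁ * (2 * (D : ℝ)) = c ^ 2 * D / 16 := by rw [hδ₁]; ring
        _ ≤ n d₁ := hn
  choose! qf hqf1 hqf2 hqf3 using hvin₁
  -- Step 6: a popular denominator
  set K : ℕ := ⌊2 / δ₁⌋₊ with hKdef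
  have hK1 : 1 ≤ K := by
    rw [hKdef]
    refine Nat.le_floor ?_
    rw [hδ₁]; push_cast
    rw [le_div_iff₀ (by positivity)]
    linarith only [hc2]
  have hKle : (K : ℝ) ≤ 2 / δ₁ := Nat.floor_le (by positivity)
  obtain ⟨q₀, hq₀1, hq₀K, hpop⟩ := exists_popular_label Gd qf hK1 fun d₁ hd₁ =>
    ⟨hqf1 d₁ hd₁, Nat.le_floor (hqf2 d₁ hd₁)⟩
  set H := Gd.filter fun d₁ => qf d₁ = q₀ with hHdef
  -- Step 7: the Vinogradov lemma in `d₁`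
  set δ₂ : ℝ := c ^ 4 / 1024 with hδ₂
  have hδ₂0 : 0 < δ₂ := by positivity
  have hδ₂1 : δ₂ ≤ 1 := by rw [hδ₂]; linarith
  set ε₂ : ℝ := 48 * (2 * ε) / (δ₁ ^ 2 * (2 * D : ℕ)) with hε₂def
  have hε₂eq : ε₂ = 48 * 1024 * ε / (c ^ 4 * D) := by
    rw [hε₂def, hδ₁]; push_cast
    field_simp
    ring
  have hε₂0 : 0 < ε₂ := by rw [hε₂eq]; positivity
  have hHcard : δ₂ * D ≤ #((Icc 1 D).filter fun d₁ : ℕ => distInt ((d₁ : ℝ) * (q₀ * κ)) ≤ ε₂) := by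
    have hsub : H ⊆ (Icc 1 D).filter fun d₁ : ℕ => distInt ((d₁ : ℝ) * (q₀ * κ)) ≤ ε₂ := by
      intro d₁ hd₁
      rw [hHdef, Finset.mem_filter] at hd₁
      obtain ⟨hd₁G, hq⟩ := hd₁
      refine Finset.mem_filter.mpr ⟨(Finset.mem_filter.mp hd₁G).1, ?_⟩
      have h := hqf3 d₁ hd₁G
      rw [hq] at h
      have e : (d₁ : ℝ) * (q₀ * κ) = (q₀ : ℝ) * (κ * d₁) := by ring
      rw [e]; exact h
    have h1 : (#H : ℝ) ≤ #((Icc 1 D).filter fun d₁ : ℕ => distInt ((d₁ : ℝ) * (q₀ * κ)) ≤ ε₂) := by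
      exact_mod_cast Finset.card_le_card hsub
    refine le_trans ?_ (hpop.trans h1)
    -- `δ₂ D ≤ #Gd / K`
    have hK0 : (0 : ℝ) < K := by exact_mod_cast hK1
    rw [le_div_iff₀ hK0]
    have h2 : (K : ℝ) ≤ 64 / c ^ 2 := by
      refine hKle.trans (le_of_eq ?_); rw [hδ₁]; field_simp; norm_num
    calc δ₂ * D * K ≤ δ₂ * D * (64 / c ^ 2) := mul_le_mul_of_nonneg_left h2 (by positivity)
      _ = c ^ 2 * D / 16 := by rw [hδ₂]; field_simp; ring
      _ ≤ 3 * c ^ 2 * D / 32 := by linarith only [show (0 : ℝ) ≤ c ^ 2 * D by positivity]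
      _ ≤ #Gd := hGdcard
  have hvin₂ : ∃ q : ℕ, 1 ≤ q ∧ (q : ℝ) ≤ 2 / δ₂ ∧
      distInt ((q : ℝ) * (q₀ * κ)) ≤ 48 * ε₂ / (δ₂ ^ 2 * D) := by
    refine vinogradov_distInt hδ₂0 hδ₂1 hε₂0 ?_ ?_ hHcard
    · rw [hε₂eq, hδ₂, div_le_div_iff₀ (by positivity) (by positivity)]
      linarith only [hε₁, hc2, hD]
    · rw [div_le_iff₀ (pow_pos hδ₂0 2)]
      calc (24 : ℝ) ≤ c ^ 8 * D / 2 ^ 20 := by linarith only [hD]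
        _ = (D : ℝ) * δ₂ ^ 2 := by rw [hδ₂]; ring
  obtain ⟨q', hq'1, hq'2, hq'3⟩ := hvin₂
  -- Step 8: assemble
  refine ⟨q' * q₀, Nat.one_le_iff_ne_zero.mpr (Nat.mul_ne_zero (by omega) (by omega)), ?_, ?_⟩
  · have h1 : (q₀ : ℝ) ≤ 64 / c ^ 2 := by
      calc (q₀ : ℝ) ≤ K := by exact_mod_cast hq₀K
        _ ≤ 2 / δ₁ := hKle
        _ = 64 / c ^ 2 := by rw [hδ₁]; field_simp; norm_num
    have h2 : (q' : ℝ) ≤ 2048 / c ^ 4 := by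
      refine hq'2.trans (le_of_eq ?_); rw [hδ₂]; field_simp; norm_num
    push_cast
    calc (q' : ℝ) * q₀ ≤ (2048 / c ^ 4) * (64 / c ^ 2) :=
          mul_le_mul h2 h1 (Nat.cast_nonneg _) (by positivity)
      _ = 2 ^ 17 / c ^ 6 := by field_simp; norm_num
  · have e : ((q' * q₀ : ℕ) : ℝ) * κ = (q' : ℝ) * (q₀ * κ) := by push_cast; ring
    rw [e]
    refine hq'3.trans ?_
    rw [hε₂eq, hδ₂]
    exact final_bound c ε D hc0 hD0 hε0.le

end Literature.NumberTheory.Sieve.QuadraticMoebius
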